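import Literature.Probability.Percolation.CouplingMachine
import Literature.Probability.Percolation.SiteEnhancedClusterModification
import HarnessLib

/-!
# The exploration of the enhanced SITE cluster as an abstract machine (Martineau–Severo 2019, §5,
# site adaptation)

Support file of the inline proof of the site version of Martineau–Severo's Corollary 2.2
(`MartineauSevero2019_cor22_site`, Proposition 4.1, the coupling); site twin of the tree's
`CouplingMachine.lean`. Martineau–Severo (Ann. Probab. 47 (2019), §5 and Remark 4) explore the enhanced
cluster algorithmically; for site percolation the `p`-exploration queries SITES: a site `v` adjacent to the
current explored set (or an explored, not yet queried site itself) is queried once and for all ("each vertex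
has `M` possible states, and it is `p`-open if one of its `p̂`-states says so"), and the `s`-exploration of an
explored vertex `u` whose ball `B_r(u)` is entirely queried-open reads the mark of `u` and, on success, adds
the sphere `S_{r+1}(u)`.

This file is the `ℋ`-level bookkeeping of that exploration as a `TExplore.Machine`
(`CoveringQuotientExploration.lean`), for the enhanced site cluster of `SiteEnhancedCluster.lean` in the
finite volume `B_{L+r}(o)`; nothing probabilistic happens here:

* `SiteCoupling.SHState`, `SiteCoupling.nq`, `SiteCoupling.hstep`, `SiteCoupling.machine` — the state
  (explored vertices `A`, queried sites `Qd` with their query data `src`, queried sites found open `O`,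
  bonus-attempted vertices `Y`), the next query (an unqueried site `v` with `v = a` or `v ∼ a` for an explored
  `a` with `d(o,a) < L + r` first; else the bonus of an explored, un-attempted `u` with `d(o,u) < L` whose ball
  `B_r(u)` is queried-open), the update, and the machine (a site query reads `N` coins in some-mode, a bonus
  reads `N` coins in all-mode); the queries are the tree's `Coupling.Query` (`Query.edge a v` = "site `v`
  probed from `a`", `Query.bonus u`);
* structural invariants (`inv_stateOf`), monotonicity, the **halting bound** (`nq_eq_none_of_length`:
  after `|B_{L+r+1}(o)| + |B_L(o)| + 1` steps the machine has halted);
* **correctness** relative to a pair `(ω, α)` answering the queries (`Consistent`): the explored set is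
  contained in `𝒞_o(ω, α)` and, once halted, is closed under the two rules at vertices of `B_{L-1}(o)`, so
  that "a vertex at distance `≥ L` was explored" is exactly the event `𝓔_L` (`reachState_iff_of_halted`).

## References

* S. Martineau, F. Severo, Ann. Probab. 47 (2019), §5 (Structure of the process; Steps `2K+1`, `2K+2`;
  Remark 4: site adaptation) [MartineauSevero2019].
-/

noncomputable section

namespace Literature.Probability.Percolation

open Literature.Barriers.CriticalPhenomena ProbeHistory Coupling
open scoped Classical

namespace SiteCoupling

variable {Q : Type*}

/-- The state of the site exploration: explored vertices `A`, queried sites `Qd` with their query data `src`,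
queried sites found open `O`, vertices `Y` whose bonus was attempted.
[cite: MartineauSevero2019, §5 (C_{ℓ,n} and the p- and s-explored objects); Remark 4] -/
structure SHState (Q : Type*) where
  /-- explored vertices (the enhanced site cluster found so far) -/
  A : Finset Q
  /-- queried sites of `ℋ` -/
  Qd : Finset Q
  /-- queried sites found open -/
  O : Finset Q
  /-- vertices whose bonus has been attempted -/
  Y : Finset Q
  /-- for a queried site, the ordered pair (explored source, the site) it was queried as -/
  src : Q → Q × Q

/-- The initial state: only the root is explored, nothing queried. [cite: MartineauSevero2019, §5 (Step 0)] -/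
def SHState.init (o : Q) : SHState Q := ⟨{o}, ∅, ∅, ∅, fun _ => (o, o)⟩

variable (H : SimpleGraph Q) [H.LocallyFinite] (o : Q) (r L : ℕ)

/-- The ball `B_r(u)` is *queried-open* in the state `σ`: all its sites (including `u`) are queried-open.
[cite: MartineauSevero2019, §5 (Step 2K+2: "whose r-ball is fully open")] -/
def ballOpen (σ : SHState Q) (u : Q) : Prop := ∀ v ∈ ballFin H u r, v ∈ σ.O

/-- **The next query** (`none` = halt): an unqueried site `v` with `v = a` or `v ∼ a` for an explored vertex
`a` with `d(o,a) < L + r` if any (`p`-exploration first), else the bonus of an explored, un-attempted vertex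
`u` with `d(o,u) < L` whose ball is queried-open. [cite: MartineauSevero2019, §5 (Steps 2K+1, 2K+2; Remark 4)] -/
def nq (σ : SHState Q) : Option (Query Q) :=
  if h : ∃ q : Q × Q, q.1 ∈ σ.A ∧ (q.2 = q.1 ∨ H.Adj q.1 q.2) ∧ H.dist o q.1 < L + r ∧ q.2 ∉ σ.Qd then
    some (Query.edge h.choose.1 h.choose.2)
  else if h' : ∃ u : Q, u ∈ σ.A ∧ H.dist o u < L ∧ u ∉ σ.Y ∧ ballOpen H r σ u then
    some (Query.bonus h'.choose)
  else none

/-- **One step**: record the query and, on a positive answer, add the queried site (site query) or the sphere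
`S_{r+1}(u)` (bonus). [cite: MartineauSevero2019, §5 (Steps 2K+1, 2K+2)] -/
def hstep (σ : SHState Q) : Query Q → Bool → SHState Q
  | Query.edge a b, ans =>
    { A := if ans then insert b σ.A else σ.A
      Qd := insert b σ.Qd
      O := if ans then insert b σ.O else σ.O
      Y := σ.Y
      src := Function.update σ.src b (a, b) }
  | Query.bonus u, ans =>
    { A := if ans then σ.A ∪ sphereF H u (r + 1) else σ.A
      Qd := σ.Qd
      O := σ.O
      Y := insert u σ.Y
      src := σ.src }

/-- **The machine**: a site query reads `N` coins in some-mode (the `N` copies of a site; open iff some copy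
is), a bonus reads `N` coins in all-mode. [cite: MartineauSevero2019, §5 Remark 4 ("each vertex has M possible states")] -/
def machine (N : ℕ) : TExplore.Machine (SHState Q) (Query Q) where
  init := SHState.init o
  nq := nq H o r L
  step := hstep H r
  qsize := fun _ => N
  allMode := fun q => match q with
    | Query.edge _ _ => false
    | Query.bonus _ => true

variable {H o r L}

/-! ### Specifications of the next query -/

/-- What a site query guarantees. [cite: MartineauSevero2019, §5 (Step 2K+1)] -/
theorem nq_edge_spec {σ : SHState Q} {a b : Q} (h : nq H o r L σ = some (Query.edge a b)) :
    a ∈ σ.A ∧ (b = a ∨ H.Adj a b) ∧ H.dist o a < L + r ∧ b ∉ σ.Qd := by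
  unfold nq at h
  split_ifs at h with h1 h2
  · simp only [Option.some.injEq, Query.edge.injEq] at h
    obtain ⟨rfl, rfl⟩ := h
    exact h1.choose_spec
  · simp at h

/-- What a bonus query guarantees: no site query was available, and the vertex is explored, close to the root,
un-attempted, with queried-open ball. [cite: MartineauSevero2019, §5 (Step 2K+2)] -/
theorem nq_bonus_spec {σ : SHState Q} {u : Q} (h : nq H o r L σ = some (Query.bonus u)) :
    (¬ ∃ q : Q × Q, q.1 ∈ σ.A ∧ (q.2 = q.1 ∨ H.Adj q.1 q.2) ∧ H.dist o q.1 < L + r ∧ q.2 ∉ σ.Qd) ∧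
      u ∈ σ.A ∧ H.dist o u < L ∧ u ∉ σ.Y ∧ ballOpen H r σ u := by
  unfold nq at h
  split_ifs at h with h1 h2
  · simp at h
  · simp only [Option.some.injEq, Query.bonus.injEq] at h
    subst h
    exact ⟨h1, h2.choose_spec⟩

/-- The machine halts iff every site equal or adjacent to an explored vertex of `B_{L+r-1}(o)` is queried and
every admissible explored vertex with queried-open ball has had its bonus attempted. [cite: MartineauSevero2019, §5] -/
theorem nq_eq_none_iff {σ : SHState Q} :
    nq H o r L σ = none ↔
      (∀ a ∈ σ.A, ∀ b, (b = a ∨ H.Adj a b) → H.dist o a < L + r → b ∈ σ.Qd) ∧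
      (∀ u ∈ σ.A, H.dist o u < L → ballOpen H r σ u → u ∈ σ.Y) := by
  unfold nq
  split_ifs with h1 h2
  · constructor
    · intro h; cases h
    · rintro ⟨hall, -⟩
      obtain ⟨⟨a, b⟩, ha, hab, hd, hQ⟩ := h1
      exact absurd (hall a ha b hab hd) hQ
  · constructor
    · intro h; cases h
    · rintro ⟨-, hall⟩
      obtain ⟨u, hu, hd, hY, hopen⟩ := h2
      exact absurd (hall u hu hd hopen) hY
  · simp only [true_iff]
    exact ⟨fun a ha b hab hd => by_contra fun hQ => h1 ⟨(a, b), ha, hab, hd, hQ⟩,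
      fun u hu hd hopen => by_contra fun hY => h2 ⟨u, hu, hd, hY, hopen⟩⟩

/-! ### The replayed state -/

variable {N : ℕ}

variable (H o r L N) in
/-- The replayed state of the site coupling machine after a transcript. [cite: MartineauSevero2019, §5] -/
abbrev stateOf (b : List Bool) : SHState Q := TExplore.stateOf (machine H o r L N) b

/-- Unfolding the replayed state on a cons. [cite: MartineauSevero2019, §5 (Structure of the process)] -/
theorem stateOf_cons (a : Bool) (b : List Bool) :
    stateOf H o r L N (a :: b) = (match nq H o r L (stateOf H o r L N b) with
      | none => stateOf H o r L N b
      | some q => hstep H r (stateOf H o r L N b) q a) := by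
  cases hq : nq H o r L (stateOf H o r L N b) with
  | none =>
    have h' : (machine H o r L N).nq (TExplore.stateOf (machine H o r L N) b) = none := hq
    show TExplore.stateOf (machine H o r L N) (a :: b) = _
    rw [TExplore.stateOf_cons, h']
  | some q =>
    have h' : (machine H o r L N).nq (TExplore.stateOf (machine H o r L N) b) = some q := hq
    show TExplore.stateOf (machine H o r L N) (a :: b) = _
    rw [TExplore.stateOf_cons, h']
    rfl

/-- Once halted, the replayed state is frozen. [cite: MartineauSevero2019, §5 (Structure of the process)] -/
theorem stateOf_cons_of_none {b : List Bool} (h : nq H o r L (stateOf H o r L N b) = none) (a : Bool) :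
    stateOf H o r L N (a :: b) = stateOf H o r L N b := by
  rw [stateOf_cons, h]

/-- A productive step. [cite: MartineauSevero2019, §5 (Structure of the process)] -/
theorem stateOf_cons_of_some {b : List Bool} {q : Query Q} (h : nq H o r L (stateOf H o r L N b) = some q)
    (a : Bool) : stateOf H o r L N (a :: b) = hstep H r (stateOf H o r L N b) q a := by
  rw [stateOf_cons, h]

/-- The initial replayed state. [cite: MartineauSevero2019, §5 (Step 0)] -/
@[simp] theorem stateOf_nil : stateOf H o r L N [] = SHState.init o := rfl

/-! ### The fields of `hstep` -/

/-- Explored vertices after a site query. [cite: MartineauSevero2019, §5 (Step 2K+1)] -/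
theorem mem_A_hstep_edge {σ : SHState Q} {a c : Q} {ans : Bool} {v : Q} :
    v ∈ (hstep H r σ (Query.edge a c) ans).A ↔ v ∈ σ.A ∨ (ans = true ∧ v = c) := by
  cases ans <;> simp [hstep, or_comm]

/-- Queried sites after a site query. [cite: MartineauSevero2019, §5 (Step 2K+1)] -/
theorem mem_Qd_hstep_edge {σ : SHState Q} {a c : Q} {ans : Bool} {v : Q} :
    v ∈ (hstep H r σ (Query.edge a c) ans).Qd ↔ v = c ∨ v ∈ σ.Qd := by
  simp [hstep]

/-- Open queried sites after a site query. [cite: MartineauSevero2019, §5 (Step 2K+1)] -/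
theorem mem_O_hstep_edge {σ : SHState Q} {a c : Q} {ans : Bool} {v : Q} :
    v ∈ (hstep H r σ (Query.edge a c) ans).O ↔ v ∈ σ.O ∨ (ans = true ∧ v = c) := by
  cases ans <;> simp [hstep, or_comm]

/-- Attempted vertices after a site query. [cite: MartineauSevero2019, §5 (Step 2K+1)] -/
theorem Y_hstep_edge {σ : SHState Q} {a c : Q} {ans : Bool} : (hstep H r σ (Query.edge a c) ans).Y = σ.Y := rfl

/-- Query data after a site query. [cite: MartineauSevero2019, §5 (Step 2K+1)] -/
theorem src_hstep_edge {σ : SHState Q} {a c : Q} {ans : Bool} :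
    (hstep H r σ (Query.edge a c) ans).src = Function.update σ.src c (a, c) := rfl

/-- The query datum of the site just queried. [cite: MartineauSevero2019, §5 (Step 2K+1)] -/
theorem src_hstep_edge_self {σ : SHState Q} {a c : Q} {ans : Bool} :
    (hstep H r σ (Query.edge a c) ans).src c = (a, c) := by
  rw [src_hstep_edge, Function.update_self]

/-- Explored vertices after a bonus. [cite: MartineauSevero2019, §5 (Step 2K+2)] -/
theorem mem_A_hstep_bonus {σ : SHState Q} {u : Q} {ans : Bool} {v : Q} :
    v ∈ (hstep H r σ (Query.bonus u) ans).A ↔ v ∈ σ.A ∨ (ans = true ∧ v ∈ sphereF H u (r + 1)) := by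
  cases ans <;> simp [hstep]

/-- Queried sites after a bonus. [cite: MartineauSevero2019, §5 (Step 2K+2)] -/
theorem Qd_hstep_bonus {σ : SHState Q} {u : Q} {ans : Bool} : (hstep H r σ (Query.bonus u) ans).Qd = σ.Qd := rfl

/-- Open queried sites after a bonus. [cite: MartineauSevero2019, §5 (Step 2K+2)] -/
theorem O_hstep_bonus {σ : SHState Q} {u : Q} {ans : Bool} : (hstep H r σ (Query.bonus u) ans).O = σ.O := rfl

/-- Attempted vertices after a bonus. [cite: MartineauSevero2019, §5 (Step 2K+2)] -/
theorem mem_Y_hstep_bonus {σ : SHState Q} {u : Q} {ans : Bool} {y : Q} :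
    y ∈ (hstep H r σ (Query.bonus u) ans).Y ↔ y = u ∨ y ∈ σ.Y := by
  simp [hstep]

/-- Query data after a bonus. [cite: MartineauSevero2019, §5 (Step 2K+2)] -/
theorem src_hstep_bonus {σ : SHState Q} {u : Q} {ans : Bool} : (hstep H r σ (Query.bonus u) ans).src = σ.src := rfl

/-! ### The halting bound -/

/-- The potential `|Qd| + |Y|` grows by one at every productive step. [cite: MartineauSevero2019, §5 ("after finitely … many iterations")] -/
theorem card_hstep {σ : SHState Q} {q : Query Q} (h : nq H o r L σ = some q) (a : Bool) :
    (hstep H r σ q a).Qd.card + (hstep H r σ q a).Y.card = σ.Qd.card + σ.Y.card + 1 := by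
  cases q with
  | edge a' b' =>
    obtain ⟨-, -, -, hQ⟩ := nq_edge_spec h
    simp [hstep, Finset.card_insert_of_notMem hQ]
    omega
  | bonus u =>
    obtain ⟨-, -, -, hY, -⟩ := nq_bonus_spec h
    simp [hstep, Finset.card_insert_of_notMem hY]
    omega

/-- Queried sites lie in `B_{L+r+1}(o)` and attempted vertices in `B_L(o)`, for every transcript.
[cite: MartineauSevero2019, §5 ("after finitely … many iterations")] -/
theorem Qd_subset_Y_subset (hH : H.Connected) (b : List Bool) :
    (stateOf H o r L N b).Qd ⊆ ballFin H o (L + r + 1) ∧ (stateOf H o r L N b).Y ⊆ ballFin H o L := by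
  induction b with
  | nil => simp [stateOf, TExplore.stateOf, machine, SHState.init]
  | cons a b ih =>
    cases hq : nq H o r L (stateOf H o r L N b) with
    | none => rw [stateOf_cons_of_none hq]; exact ih
    | some q =>
      rw [stateOf_cons_of_some hq]
      cases q with
      | edge a' b' =>
        obtain ⟨-, hab, hd, -⟩ := nq_edge_spec hq
        simp only [hstep]
        refine ⟨Finset.insert_subset ?_ ih.1, ih.2⟩
        rw [mem_ballFin]
        refine mem_graphBall_of_dist_le hH ?_
        rcases hab with rfl | hab
        · omega
        · have := hH.dist_triangle (u := o) (v := a') (w := b')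
          rw [SimpleGraph.dist_eq_one_iff_adj.2 hab] at this
          omega
      | bonus u =>
        obtain ⟨-, -, hd, -, -⟩ := nq_bonus_spec hq
        simp only [hstep]
        exact ⟨ih.1, Finset.insert_subset (mem_ballFin.2 (mem_graphBall_of_dist_le hH hd.le)) ih.2⟩

/-- If the machine has not halted after the transcript `b`, then every step of `b` was productive and
`|b| ≤ |Qd| + |Y|`. [cite: MartineauSevero2019, §5 ("after finitely … many iterations")] -/
theorem length_le_of_nq_ne_none (b : List Bool) (h : nq H o r L (stateOf H o r L N b) ≠ none) :
    b.length ≤ (stateOf H o r L N b).Qd.card + (stateOf H o r L N b).Y.card := by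
  induction b with
  | nil => simp
  | cons a b ih =>
    cases hq : nq H o r L (stateOf H o r L N b) with
    | none => exact absurd (by rw [stateOf_cons_of_none hq]; exact hq) h
    | some q =>
      rw [stateOf_cons_of_some hq, card_hstep hq, List.length_cons]
      have := ih (by rw [hq]; simp)
      omega

variable (H o r L) in
/-- The halting time `|B_{L+r+1}(o)| + |B_L(o)| + 1`. [cite: MartineauSevero2019, §5 ("after finitely … many iterations")] -/
def haltBound : ℕ := (ballFin H o (L + r + 1)).card + (ballFin H o L).card + 1

/-- **Halting bound**: after any transcript of length `≥ haltBound` the machine has halted. [cite: MartineauSevero2019, §5] -/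
theorem nq_eq_none_of_length (hH : H.Connected) (b : List Bool) (hb : haltBound H o r L ≤ b.length) :
    nq H o r L (stateOf H o r L N b) = none := by
  by_contra h
  have h1 := length_le_of_nq_ne_none b h
  have h2 := Qd_subset_Y_subset (H := H) (o := o) (r := r) (L := L) (N := N) hH b
  have := Finset.card_le_card h2.1
  have := Finset.card_le_card h2.2
  unfold haltBound at hb
  omega

/-- **The exploration has halted at time `haltBound`** along every run of a good encoding.
[cite: MartineauSevero2019, §5] -/
theorem nq_stateOf_bt_eq_none {W : Type*} {enc : List Bool → Query Q → Finset (Sym2 W)} {Gc : SimpleGraph W}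
    (hH : H.Connected) (hE : TExplore.GoodEnc (machine H o r L N) enc Gc) {k : ℕ} (hk : haltBound H o r L ≤ k)
    (ω : BondConfig W) :
    nq H o r L (stateOf H o r L N (TExplore.bt (machine H o r L N) ((TExplore.texpl (machine H o r L N) enc).hist k ω))) = none := by
  by_contra h
  have hlen := TExplore.length_bt_hist hE k ω h
  exact h (nq_eq_none_of_length hH _ (by rw [hlen]; exact hk))

/-! ### Structural invariants -/

/-- The structural invariants of a replayed state: the root is explored; open queried sites are queried and
explored; a queried site `v` has `src v = (a, v)` with `a` explored, `d(o,a) < L + r` and `v = a` or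
`a ∼ v`; explored vertices lie in `B_{L+r}(o)`; an explored vertex other than the root is queried.
[cite: MartineauSevero2019, §5 (Conditions maintained at each iteration)] -/
structure Inv (σ : SHState Q) : Prop where
  root : o ∈ σ.A
  O_sub : ∀ v ∈ σ.O, v ∈ σ.Qd
  Qd_src : ∀ v ∈ σ.Qd, (σ.src v).2 = v ∧ (v = (σ.src v).1 ∨ H.Adj (σ.src v).1 v) ∧
    (σ.src v).1 ∈ σ.A ∧ H.dist o (σ.src v).1 < L + r
  O_A : ∀ v ∈ σ.O, v ∈ σ.A
  A_ball : ∀ v ∈ σ.A, H.dist o v ≤ L + r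
  A_Qd : ∀ v ∈ σ.A, v ≠ o → v ∈ σ.Qd

/-- **The invariants hold along every transcript.** [cite: MartineauSevero2019, §5] -/
theorem inv_stateOf (hH : H.Connected) (b : List Bool) : Inv (H := H) (o := o) (r := r) (L := L) (stateOf H o r L N b) := by
  induction b with
  | nil =>
    refine ⟨?_, ?_, ?_, ?_, ?_, ?_⟩ <;>
      simp [stateOf, TExplore.stateOf, machine, SHState.init]
  | cons ans b ih =>
    cases hq : nq H o r L (stateOf H o r L N b) with
    | none => rw [stateOf_cons_of_none hq]; exact ih
    | some q =>
      rw [stateOf_cons_of_some hq]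
      cases q with
      | edge a c =>
        obtain ⟨ha, hac, hd, hQ⟩ := nq_edge_spec hq
        have hAmono : ∀ v ∈ (stateOf H o r L N b).A, v ∈ (hstep H r (stateOf H o r L N b) (Query.edge a c) ans).A :=
          fun v hv => mem_A_hstep_edge.2 (Or.inl hv)
        refine ⟨hAmono _ ih.root, ?_, ?_, ?_, ?_, ?_⟩
        · intro v hv
          rw [mem_Qd_hstep_edge]
          rcases mem_O_hstep_edge.1 hv with hv | ⟨-, rfl⟩
          · exact Or.inr (ih.O_sub v hv)
          · exact Or.inl rfl
        · intro v hv
          rw [src_hstep_edge]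
          rcases mem_Qd_hstep_edge.1 hv with rfl | hv'
          · rw [Function.update_self]
            exact ⟨rfl, hac, hAmono _ ha, hd⟩
          · have hne : v ≠ c := fun h => hQ (h ▸ hv')
            rw [Function.update_of_ne hne]
            obtain ⟨h1, h2, h3, h4⟩ := ih.Qd_src v hv'
            exact ⟨h1, h2, hAmono _ h3, h4⟩
        · intro v hv
          rcases mem_O_hstep_edge.1 hv with hv | ⟨hans, rfl⟩
          · exact hAmono _ (ih.O_A v hv)
          · exact mem_A_hstep_edge.2 (Or.inr ⟨hans, rfl⟩)
        · intro v hv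
          rcases mem_A_hstep_edge.1 hv with hv | ⟨-, rfl⟩
          · exact ih.A_ball v hv
          · rcases hac with rfl | hac
            · omega
            · have := hH.dist_triangle (u := o) (v := a) (w := v)
              rw [SimpleGraph.dist_eq_one_iff_adj.2 hac] at this
              omega
        · intro v hv hvo
          rw [mem_Qd_hstep_edge]
          rcases mem_A_hstep_edge.1 hv with hv | ⟨-, rfl⟩
          · exact Or.inr (ih.A_Qd v hv hvo)
          · exact Or.inl rfl
      | bonus u =>
        obtain ⟨hnone, hu, hd, hY, hopen⟩ := nq_bonus_spec hq
        have hAmono : ∀ v ∈ (stateOf H o r L N b).A, v ∈ (hstep H r (stateOf H o r L N b) (Query.bonus u) ans).A :=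
          fun v hv => mem_A_hstep_bonus.2 (Or.inl hv)
        refine ⟨hAmono _ ih.root, ?_, ?_, ?_, ?_, ?_⟩
        · intro v hv
          rw [Qd_hstep_bonus]
          rw [O_hstep_bonus] at hv
          exact ih.O_sub v hv
        · intro v hv
          rw [Qd_hstep_bonus] at hv
          rw [src_hstep_bonus]
          obtain ⟨h1, h2, h3, h4⟩ := ih.Qd_src v hv
          exact ⟨h1, h2, hAmono _ h3, h4⟩
        · intro v hv
          rw [O_hstep_bonus] at hv
          exact hAmono _ (ih.O_A v hv)
        · intro v hv
          rcases mem_A_hstep_bonus.1 hv with hv | ⟨-, hv⟩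
          · exact ih.A_ball v hv
          · rw [sphereF, Finset.mem_filter] at hv
            have := hH.dist_triangle (u := o) (v := u) (w := v)
            omega
        · -- a sphere vertex is adjacent to a queried-open (hence explored) vertex of `B_r(u)`, so it was queried
          intro v hv hvo
          rw [Qd_hstep_bonus]
          rcases mem_A_hstep_bonus.1 hv with hv | ⟨-, hv⟩
          · exact ih.A_Qd v hv hvo
          · rw [sphereF, Finset.mem_filter] at hv
            obtain ⟨v₀, hadj, hv₀⟩ := exists_adj_mem_graphBall_of_dist_eq hH hv.2
            have hv₀A : v₀ ∈ (stateOf H o r L N b).A := ih.O_A v₀ (hopen v₀ (mem_ballFin.2 hv₀))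
            by_contra hvQ
            refine hnone ⟨(v₀, v), hv₀A, Or.inr hadj, ?_, hvQ⟩
            have := dist_le_of_mem_graphBall hv₀
            have := hH.dist_triangle (u := o) (v := u) (w := v₀)
            show H.dist o v₀ < L + r
            omega

/-- Monotonicity of the state along a transcript: `A`, `Qd`, `O`, `Y` only grow, and `src` is frozen on
queried sites. [cite: MartineauSevero2019, §5 (Structure of the process)] -/
theorem mono_cons (ans : Bool) (b : List Bool) :
    (stateOf H o r L N b).A ⊆ (stateOf H o r L N (ans :: b)).A ∧
    (stateOf H o r L N b).Qd ⊆ (stateOf H o r L N (ans :: b)).Qd ∧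
    (stateOf H o r L N b).O ⊆ (stateOf H o r L N (ans :: b)).O ∧
    (stateOf H o r L N b).Y ⊆ (stateOf H o r L N (ans :: b)).Y ∧
    (∀ v ∈ (stateOf H o r L N b).Qd, (stateOf H o r L N (ans :: b)).src v = (stateOf H o r L N b).src v) := by
  cases hq : nq H o r L (stateOf H o r L N b) with
  | none => rw [stateOf_cons_of_none hq]; exact ⟨subset_rfl, subset_rfl, subset_rfl, subset_rfl, fun _ _ => rfl⟩
  | some q =>
    rw [stateOf_cons_of_some hq]
    cases q with
    | edge a c =>
      obtain ⟨-, -, -, hQ⟩ := nq_edge_spec hq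
      refine ⟨fun v hv => mem_A_hstep_edge.2 (Or.inl hv), fun v hv => mem_Qd_hstep_edge.2 (Or.inr hv),
        fun v hv => mem_O_hstep_edge.2 (Or.inl hv), fun y hy => by rw [Y_hstep_edge]; exact hy,
        fun v hv => ?_⟩
      have hne : v ≠ c := fun h => hQ (h ▸ hv)
      rw [src_hstep_edge, Function.update_of_ne hne]
    | bonus u =>
      exact ⟨fun v hv => mem_A_hstep_bonus.2 (Or.inl hv), fun v hv => by rw [Qd_hstep_bonus]; exact hv,
        fun v hv => by rw [O_hstep_bonus]; exact hv, fun y hy => mem_Y_hstep_bonus.2 (Or.inr hy),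
        fun v _ => by rw [src_hstep_bonus]⟩

/-- Monotonicity along an extension of the transcript. [cite: MartineauSevero2019, §5 (Structure of the process)] -/
theorem mono_append (b' b : List Bool) :
    (stateOf H o r L N b).A ⊆ (stateOf H o r L N (b' ++ b)).A ∧
    (stateOf H o r L N b).Qd ⊆ (stateOf H o r L N (b' ++ b)).Qd ∧
    (stateOf H o r L N b).O ⊆ (stateOf H o r L N (b' ++ b)).O ∧
    (stateOf H o r L N b).Y ⊆ (stateOf H o r L N (b' ++ b)).Y ∧
    (∀ v ∈ (stateOf H o r L N b).Qd, (stateOf H o r L N (b' ++ b)).src v = (stateOf H o r L N b).src v) := by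
  induction b' with
  | nil => exact ⟨subset_rfl, subset_rfl, subset_rfl, subset_rfl, fun _ _ => rfl⟩
  | cons a b' ih =>
    obtain ⟨h1, h2, h3, h4, h5⟩ := mono_cons (H := H) (o := o) (r := r) (L := L) (N := N) a (b' ++ b)
    obtain ⟨i1, i2, i3, i4, i5⟩ := ih
    refine ⟨i1.trans h1, i2.trans h2, i3.trans h3, i4.trans h4, fun v hv => ?_⟩
    rw [List.cons_append, h5 v (i2 hv), i5 v hv]

/-! ### Correctness relative to a pair `(ω, α)` answering the queries -/

section Consistent

variable (ω : Set Q) (α : Set Q)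

/-- The transcript `b` is *consistent* with `(ω, α)`: every recorded answer to a site query is "the site is
open in `ω`", and to a bonus query "the vertex is marked in `α`".
[cite: MartineauSevero2019, §5 ("C_∞ … is the cluster of the origin of ((∨_k ω_{e,k})_e, α)")] -/
def Consistent : List Bool → Prop
  | [] => True
  | a :: b => Consistent b ∧
      match nq H o r L (stateOf H o r L N b) with
      | none => True
      | some (Query.edge _ y) => (a = true ↔ y ∈ ω)
      | some (Query.bonus u) => (a = true ↔ u ∈ α)

variable {ω α}

/-- **Semantic invariants** of a consistent transcript: a queried site is recorded open iff it is open in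
`ω`; a successful bonus swallowed the sphere; and every explored vertex lies in the enhanced site cluster
`𝒞_o(ω, α)`. [cite: MartineauSevero2019, §5 (Conditions ③, ⑤: the explored set is the enhanced cluster)] -/
theorem inv_sem (hH : H.Connected) {b : List Bool}
    (hb : Consistent (H := H) (o := o) (r := r) (L := L) (N := N) ω α b) :
    (∀ v ∈ (stateOf H o r L N b).Qd, (v ∈ (stateOf H o r L N b).O ↔ v ∈ ω)) ∧
    (∀ u ∈ (stateOf H o r L N b).Y, u ∈ α → ballOpen H r (stateOf H o r L N b) u ∧
      ∀ v ∈ sphereF H u (r + 1), v ∈ (stateOf H o r L N b).A) ∧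
    (∀ v ∈ (stateOf H o r L N b).A, v ∈ enhSiteCluster H r {o} ω α) := by
  induction b with
  | nil =>
    refine ⟨by simp [stateOf, TExplore.stateOf, machine, SHState.init],
      by simp [stateOf, TExplore.stateOf, machine, SHState.init], ?_⟩
    intro v hv
    simp only [stateOf, TExplore.stateOf, machine, SHState.init, Finset.mem_singleton] at hv
    subst hv
    exact subset_enhSiteCluster H r {v} ω α rfl
  | cons ans b ih =>
    obtain ⟨hb, hans⟩ := hb
    obtain ⟨ihO, ihY, ihA⟩ := ih hb
    have hinv := inv_stateOf (H := H) (o := o) (r := r) (L := L) (N := N) hH b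
    cases hq : nq H o r L (stateOf H o r L N b) with
    | none => rw [stateOf_cons_of_none hq]; exact ⟨ihO, ihY, ihA⟩
    | some q =>
      rw [hq] at hans
      rw [stateOf_cons_of_some hq]
      obtain ⟨mA, mQd, mO, mY, msrc⟩ := mono_cons (H := H) (o := o) (r := r) (L := L) (N := N) ans b
      rw [stateOf_cons_of_some hq] at mA mQd mO mY
      cases q with
      | edge a c =>
        simp only at hans
        obtain ⟨ha, hac, hd, hQ⟩ := nq_edge_spec hq
        refine ⟨?_, ?_, ?_⟩
        · intro v hv
          rw [mem_O_hstep_edge]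
          rcases mem_Qd_hstep_edge.1 hv with rfl | hv
          · constructor
            · rintro (h | ⟨h, -⟩)
              · exact absurd (hinv.O_sub _ h) hQ
              · exact hans.1 h
            · intro h
              exact Or.inr ⟨hans.2 h, rfl⟩
          · have hne : v ≠ c := fun h => hQ (h ▸ hv)
            constructor
            · rintro (h | ⟨-, h⟩)
              · exact (ihO v hv).1 h
              · exact absurd h hne
            · intro h
              exact Or.inl ((ihO v hv).2 h)
        · intro u hu huα
          rw [Y_hstep_edge] at hu
          obtain ⟨hopen, hsph⟩ := ihY u hu huα
          exact ⟨fun v hv => mO (hopen v hv), fun v hv => mA (hsph v hv)⟩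
        · intro v hv
          rcases mem_A_hstep_edge.1 hv with hv | ⟨h, rfl⟩
          · exact ihA v hv
          · rcases hac with rfl | hac
            · exact ihA _ ha
            · exact mem_enhSiteCluster_of_adj (ihA a ha) hac (hans.1 h)
      | bonus u =>
        simp only at hans
        obtain ⟨-, hu, hd, hY, hopen⟩ := nq_bonus_spec hq
        refine ⟨?_, ?_, ?_⟩
        · intro v hv
          rw [O_hstep_bonus]
          rw [Qd_hstep_bonus] at hv
          exact ihO v hv
        · intro u' hu' hu'α
          rcases mem_Y_hstep_bonus.1 hu' with rfl | hu'
          · refine ⟨fun v hv => mO (hopen v hv), fun v hv => ?_⟩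
            exact mem_A_hstep_bonus.2 (Or.inr ⟨hans.2 hu'α, hv⟩)
          · obtain ⟨hopen', hsph⟩ := ihY u' hu' hu'α
            exact ⟨fun v hv => mO (hopen' v hv), fun v hv => mA (hsph v hv)⟩
        · intro v hv
          rcases mem_A_hstep_bonus.1 hv with hv | ⟨h, hv⟩
          · exact ihA v hv
          · rw [sphereF, Finset.mem_filter] at hv
            refine mem_enhSiteCluster_of_bonus (ihA u hu) (hans.1 h) (fun z hz => ?_) hv.2
            have hz' : z ∈ ballFin H u r := mem_ballFin.2 hz
            exact (ihO z (hinv.O_sub z (hopen z hz'))).1 (hopen z hz')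

/-- The transcript event: an explored vertex at distance `≥ L` from the root. [cite: MartineauSevero2019, §6 (𝓔_L)] -/
def ReachState (H : SimpleGraph Q) (o : Q) (L : ℕ) (σ : SHState Q) : Prop := ∃ v ∈ σ.A, L ≤ H.dist o v

/-- **Exploration correctness.** For a consistent transcript after which the machine has halted, "an
explored vertex at distance `≥ L`" holds iff `(ω, α) ∈ 𝓔_L`. (⇒: explored vertices lie in the enhanced
cluster. ⇐: the halted explored set contains `o` and is closed under the two rules at vertices of
`B_{L-1}(o)` — an unqueried open neighbour or an un-attempted fully open ball would be a live query — so
the closure principle `exists_far_of_siteClosed` applies.)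
[cite: MartineauSevero2019, §5 (Step ∞: "C_∞ has the distribution of the cluster of the origin for the (p,s)-process on ℋ")] -/
theorem reachState_iff_of_halted (hH : H.Connected) {b : List Bool}
    (hb : Consistent (H := H) (o := o) (r := r) (L := L) (N := N) ω α b)
    (hhalt : nq H o r L (stateOf H o r L N b) = none) :
    ReachState H o L (stateOf H o r L N b) ↔ ∃ v, v ∈ enhSiteCluster H r {o} ω α ∧ L ≤ H.dist o v := by
  obtain ⟨hO, hY, hA⟩ := inv_sem (H := H) (o := o) (r := r) (L := L) (N := N) hH hb
  have hinv := inv_stateOf (H := H) (o := o) (r := r) (L := L) (N := N) hH b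
  obtain ⟨hsites, hbonus⟩ := nq_eq_none_iff.1 hhalt
  set σ := stateOf H o r L N b with hσ
  constructor
  · rintro ⟨v, hv, hvL⟩
    exact ⟨v, hA v hv, hvL⟩
  · intro hfar
    have hclosedS : ∀ u w, u ∈ (↑σ.A : Set Q) → H.dist o u < L → H.Adj u w → w ∈ ω → w ∈ (↑σ.A : Set Q) := by
      intro u w hu hud hadj hw
      have hQd : w ∈ σ.Qd := hsites u (Finset.mem_coe.1 hu) w (Or.inr hadj) (by omega)
      have hOw : w ∈ σ.O := (hO _ hQd).2 hw
      exact Finset.mem_coe.2 (hinv.O_A _ hOw)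
    have hclosedB : ∀ u w, u ∈ (↑σ.A : Set Q) → H.dist o u < L → u ∈ α → graphBall H u r ⊆ ω →
        H.dist u w = r + 1 → w ∈ (↑σ.A : Set Q) := by
      intro u w hu hud huα hball hdist
      have hu' : u ∈ σ.A := Finset.mem_coe.1 hu
      -- every vertex of `B_r(u)` is explored and queried-open
      have hballA : ∀ k, k ≤ r → ∀ z ∈ graphBall H u k, z ∈ σ.A ∧ z ∈ σ.O := by
        intro k hk
        induction k with
        | zero =>
          intro z hz
          rw [graphBall_zero, Set.mem_singleton_iff] at hz
          subst hz
          have hQd : z ∈ σ.Qd := hsites z hu' z (Or.inl rfl) (by omega)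
          exact ⟨hu', (hO _ hQd).2 (hball (mem_graphBall_self H z r))⟩
        | succ k ih =>
          intro z hz
          have ih' := ih (Nat.le_of_succ_le hk)
          rcases (mem_graphBall_succ_iff' H u z k).1 hz with rfl | ⟨z₀, hz₀, hadj⟩
          · exact ih' z (mem_graphBall_self H z k)
          · obtain ⟨hz₀A, -⟩ := ih' z₀ hz₀
            have hd₀ : H.dist o z₀ < L + r := by
              have h1 := dist_le_of_mem_graphBall hz₀
              have := hH.dist_triangle (u := o) (v := u) (w := z₀)
              omega
            have hQd : z ∈ σ.Qd := hsites z₀ hz₀A z (Or.inr hadj) hd₀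
            have hzω : z ∈ ω := hball (graphBall_mono H u hk hz)
            have hzO : z ∈ σ.O := (hO _ hQd).2 hzω
            exact ⟨hinv.O_A _ hzO, hzO⟩
      have hopen : ballOpen H r σ u := fun z hz => (hballA r le_rfl z (mem_ballFin.1 hz)).2
      have huY : u ∈ σ.Y := hbonus u hu' hud hopen
      have hsph := (hY u huY huα).2
      refine Finset.mem_coe.2 (hsph w ?_)
      rw [sphereF, Finset.mem_filter, mem_ballFin]
      exact ⟨mem_graphBall_of_dist_le hH hdist.le, hdist⟩
    obtain ⟨v, hv, hvL⟩ := exists_far_of_siteClosed (↑σ.A : Set Q) (Finset.mem_coe.2 hinv.root) hclosedS hclosedB hfar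
    exact ⟨v, Finset.mem_coe.1 hv, hvL⟩

end Consistent

end SiteCoupling

end Literature.Probability.Percolation
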